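/-
Copyright: b2b-lace packet (planner seat CARVER, gen 13). KERNEL PROOF of the unit-vector pair
multiplicities behind the hand constants of two weighted-diagram cells of the [NoBLE17]/[FvdH17]
Mathematica implementation (packet items K-A13, K-A10; DIVERGENCE D52; `carver/g13/N57-PRINTLINES.md`).
PROGRAMME-INTERNAL elementary counting: NOT CITABLE as literature; carries no verdict and no
numerical literal of the certificate.
-/
import Mathlib

/-!
# Pair sums over the `2d` unit vectors of `ℤᵈ` — the multiplicities `2d`, `2d`, `2d(2d-2)`

CITATION HEADER (PLACEMENT v9). This module belongs to the packet analysing R. Fitzner,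
R. van der Hofstad, *Generalized approach to the non-backtracking lace expansion*, PTRF 169 (2017)
1041–1119 [NoBLE17], §5.3.3 "Bounds on weighted diagrams", eq. (5.46), p. 1099:
"`𝓗^{0,2}_z(0) = (D⋆D⋆H_z)(0) = (1/(2d)²) Σ_{ι,κ} ‖e_ι+e_κ‖₂² G_z(e_ι+e_κ)`", and eq. (5.48), p. 1099
(the `e_ι+e_κ` class of `(a₂ ⊗ H_z)(0)`), with R. Fitzner, R. van der Hofstad, *Mean-field behavior
for nearest-neighbor percolation in `d > 10`*, Electron. J. Probab. 22 (2017) no. 43 [FvdH17] as the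
consumer. It does NOT reproduce a printed statement. It proves the finite counting facts by which
such a double sum over unit vectors is EVALUATED: for a fixed unit vector `e_ι` the `2d` unit
vectors `e_κ` split into `κ = ι` (one), `κ = -ι` (one: `opp ι` below) and `κ ⟂ ι` (different axis,
`2d - 2` of them); so a pair-summand that is constant on these three classes (values `b`, `c`, `a`)
sums to `2d • (b + c + (2d-2) • a)` (`sum_pair_trichotomy`). With the squared norms
`‖e_ι+e_κ‖₂² = 4, 0, 2` on the three classes this gives the exact value
`(1/(2d)²) Σ_{ι,κ} ‖e_ι+e_κ‖₂² g(e_ι+e_κ) = (1/2d) (2(2d-2)·g(e₁+e₂) + 4·g(2e₁))` for any `g` that is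
constant on each class (`sum_pair_normSq_weighted`, packet item K-A13; the printed right member of
(5.46) carries `4(2d-2)` in place of `2(2d-2)`), and the count of ordered perpendicular pairs
`2d(2d-2)` (`card_perp_pairs`, `sum_perp_pairs_const`; packet item K-A10: with weight `‖x‖₂² = 2` and
one bond-disjoint partner walk of weight `z²` per ordered perpendicular pair, the `e_ι+e_κ` class of
`z²(a₂ ⊗ H_z)(0)` evaluates to `4d(2d-2) z⁴`, where the display (5.48) prints `8d(2d-2)`).
The lattice dictionary (unit vectors as elements of `ℤᵈ`, the three norm values, class-constancy of
the two-point function by lattice symmetry) is NOT formalised here; it is the consumer's (the packet's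
`NobleSymmetry` layer). Origin: build `lace`, unit `b2b-lace-carver-g13`. [folklore] throughout.

## Main theorems

* `filter_sameAxis`, `card_sameAxis`, `card_perp` — the trichotomy counts `2` and `2d - 2`.
* `sum_pair_trichotomy` — `∑ ι, ∑ κ, w ι κ = (2d) • (b + c + (2d-2) • a)`.
* `sum_pair_normSq_weighted` — K-A13 over `ℝ`.
* `card_perp_pairs`, `sum_perp_pairs_const`, `sum_perp_pairs_normSq_real` — K-A10 counts.
-/

open Finset

namespace Literature.Probability.FitznerVanDerHofstad2017.UnitVectorPairs

variable {d : ℕ}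

/-- Index of the opposite unit vector: same axis, other sign. [folklore] -/
def opp (ι : Fin d × Bool) : Fin d × Bool := (ι.1, !ι.2)

/-- `opp` keeps the axis. [folklore] -/
@[simp] theorem opp_fst (ι : Fin d × Bool) : (opp ι).1 = ι.1 := rfl

/-- `opp` flips the sign. [folklore] -/
@[simp] theorem opp_snd (ι : Fin d × Bool) : (opp ι).2 = !ι.2 := rfl

/-- The opposite index is different. [folklore] -/
theorem opp_ne (ι : Fin d × Bool) : opp ι ≠ ι := by
  intro h
  have h2 := congrArg Prod.snd h
  simp [opp] at h2

/-- `opp` is an involution. [folklore] -/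
theorem opp_opp (ι : Fin d × Bool) : opp (opp ι) = ι := by
  simp [opp]

/-- There are `2d` unit vectors. [folklore] -/
theorem card_unitVec : Fintype.card (Fin d × Bool) = 2 * d := by
  simp [Fintype.card_prod, Fintype.card_bool, mul_comm]

/-- The unit vectors on the axis of `ι` are exactly `ι` and `opp ι`. [folklore] -/
theorem filter_sameAxis (ι : Fin d × Bool) :
    (univ.filter fun κ : Fin d × Bool => κ.1 = ι.1) = {ι, opp ι} := by
  ext κ
  simp only [mem_filter, mem_univ, true_and, mem_insert, mem_singleton]
  rcases κ with ⟨k, s⟩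
  rcases ι with ⟨i, t⟩
  simp only [opp, Prod.mk.injEq]
  constructor
  · intro h
    subst h
    cases s <;> cases t <;> simp
  · rintro (⟨h, _⟩ | ⟨h, _⟩) <;> exact h

/-- Exactly two unit vectors share the axis of `ι`. [folklore] -/
theorem card_sameAxis (ι : Fin d × Bool) :
    (univ.filter fun κ : Fin d × Bool => κ.1 = ι.1).card = 2 := by
  rw [filter_sameAxis, card_pair (opp_ne ι).symm]

/-- Exactly `2d - 2` unit vectors are perpendicular to `e_ι` (different axis). [folklore] -/
theorem card_perp (ι : Fin d × Bool) :
    (univ.filter fun κ : Fin d × Bool => ¬ κ.1 = ι.1).card = 2 * d - 2 := by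
  have h := card_filter_add_card_filter_not
    (s := (univ : Finset (Fin d × Bool))) (fun κ : Fin d × Bool => κ.1 = ι.1)
  rw [card_sameAxis, card_univ, card_unitVec] at h
  omega

/-- THE TRICHOTOMY SUM. If a pair-summand over unit vectors takes the value `b` on the diagonal
`κ = ι`, `c` on the opposite vector `κ = opp ι`, and `a` whenever `κ` is on another axis, then
`∑ ι, ∑ κ, w ι κ = (2d) • (b + c + (2d-2) • a)`. [folklore] -/
theorem sum_pair_trichotomy {R : Type*} [AddCommMonoid R]
    (w : Fin d × Bool → Fin d × Bool → R) (a b c : R)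
    (hdiag : ∀ ι, w ι ι = b) (hopp : ∀ ι, w ι (opp ι) = c)
    (hperp : ∀ ι κ, ¬ κ.1 = ι.1 → w ι κ = a) :
    ∑ ι, ∑ κ, w ι κ = (2 * d) • (b + c + (2 * d - 2) • a) := by
  have inner : ∀ ι : Fin d × Bool, ∑ κ, w ι κ = b + c + (2 * d - 2) • a := by
    intro ι
    rw [← sum_filter_add_sum_filter_not univ (fun κ : Fin d × Bool => κ.1 = ι.1)]
    congr 1
    · rw [filter_sameAxis, sum_pair (opp_ne ι).symm, hdiag, hopp]
    · rw [sum_congr rfl (fun κ hκ => hperp ι κ (by simpa using hκ)), sum_const, card_perp]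
  rw [sum_congr rfl (fun ι _ => inner ι), sum_const, card_univ, card_unitVec]

/-- K-A13 (packet): with `‖e_ι+e_κ‖₂² = 4, 0, 2` on the three classes and a two-point quantity
constant on each non-degenerate class (`g2` on the `2e₁` class, `g11` on the `e₁+e₂` class), the
double sum `Σ_{ι,κ} ‖e_ι+e_κ‖₂² g(e_ι+e_κ)` — presented abstractly as `w` — equals
`2d·(4·g2 + 2(2d-2)·g11)`; dividing by `(2d)²` gives `(1/2d)(2(2d-2) g11 + 4 g2)`, the exact value
of the middle member of [NoBLE17] (5.46). [folklore] -/
theorem sum_pair_normSq_weighted (hd : 1 ≤ d) (w : Fin d × Bool → Fin d × Bool → ℝ)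
    (g11 g2 : ℝ) (hdiag : ∀ ι, w ι ι = 4 * g2) (hopp : ∀ ι, w ι (opp ι) = 0)
    (hperp : ∀ ι κ, ¬ κ.1 = ι.1 → w ι κ = 2 * g11) :
    ∑ ι, ∑ κ, w ι κ = 2 * (d : ℝ) * (4 * g2 + 2 * (2 * (d : ℝ) - 2) * g11) := by
  rw [sum_pair_trichotomy w (2 * g11) (4 * g2) 0 hdiag hopp hperp]
  have h2 : ((2 * d - 2 : ℕ) : ℝ) = 2 * (d : ℝ) - 2 := by
    rw [Nat.cast_sub (by omega), Nat.cast_mul]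
    norm_num
  simp only [nsmul_eq_mul]
  rw [h2]
  push_cast
  ring

/-- K-A13, divided form: `(1/(2d)²) Σ = (1/2d)(2(2d-2) g11 + 4 g2)` for `d ≥ 1`. [folklore] -/
theorem sum_pair_normSq_weighted_div (hd : 1 ≤ d) (w : Fin d × Bool → Fin d × Bool → ℝ)
    (g11 g2 : ℝ) (hdiag : ∀ ι, w ι ι = 4 * g2) (hopp : ∀ ι, w ι (opp ι) = 0)
    (hperp : ∀ ι κ, ¬ κ.1 = ι.1 → w ι κ = 2 * g11) :
    (1 / (2 * (d : ℝ)) ^ 2) * ∑ ι, ∑ κ, w ι κ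
      = (1 / (2 * (d : ℝ))) * (2 * (2 * (d : ℝ) - 2) * g11 + 4 * g2) := by
  rw [sum_pair_normSq_weighted hd w g11 g2 hdiag hopp hperp]
  have hd' : (d : ℝ) ≠ 0 := by
    have : (1 : ℝ) ≤ d := by exact_mod_cast hd
    positivity
  field_simp
  ring

/-- K-A10 count (packet): a pair-summand equal to `a` on perpendicular pairs and `0` on the axis of
`ι` sums to `(2d) • ((2d-2) • a)` — there are `2d(2d-2)` ORDERED perpendicular pairs. [folklore] -/
theorem sum_perp_pairs_const {R : Type*} [AddCommMonoid R] (a : R) :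
    ∑ ι : Fin d × Bool, ∑ κ : Fin d × Bool, (if κ.1 = ι.1 then (0 : R) else a)
      = (2 * d) • ((2 * d - 2) • a) := by
  have h := sum_pair_trichotomy (d := d) (fun ι κ => if κ.1 = ι.1 then (0 : R) else a) a 0 0
    (fun ι => by simp) (fun ι => by simp [opp]) (fun ι κ hk => by simp [hk])
  simpa using h

/-- K-A10 count as a cardinality: `#{(ι, κ) : κ ⟂ ι} = 2d(2d-2)`. [folklore] -/
theorem card_perp_pairs :
    (univ.filter fun p : (Fin d × Bool) × (Fin d × Bool) => ¬ p.2.1 = p.1.1).card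
      = 2 * d * (2 * d - 2) := by
  rw [card_filter, Fintype.sum_prod_type]
  have h := sum_perp_pairs_const (d := d) (1 : ℕ)
  simp only [smul_eq_mul, mul_one] at h
  rw [← h]
  refine sum_congr rfl (fun ι _ => sum_congr rfl (fun κ _ => ?_))
  by_cases hk : κ.1 = ι.1 <;> simp [hk]

/-- K-A10, real form used by the packet: with weight `‖e_ι+e_κ‖₂² = 2` and one partner walk of
weight `x` (`= z⁴` there) per ordered perpendicular pair, the class sum is `4d(2d-2)·x` (`d ≥ 1`);
the display [NoBLE17] (5.48) prints `8d(2d-2)` for this class. [folklore] -/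
theorem sum_perp_pairs_normSq_real (hd : 1 ≤ d) (x : ℝ) :
    ∑ ι : Fin d × Bool, ∑ κ : Fin d × Bool, (if κ.1 = ι.1 then (0 : ℝ) else 2 * x)
      = 4 * (d : ℝ) * (2 * (d : ℝ) - 2) * x := by
  rw [sum_perp_pairs_const]
  have h2 : ((2 * d - 2 : ℕ) : ℝ) = 2 * (d : ℝ) - 2 := by
    rw [Nat.cast_sub (by omega), Nat.cast_mul]
    norm_num
  simp only [nsmul_eq_mul]
  rw [h2]
  push_cast
  ring

end Literature.Probability.FitznerVanDerHofstad2017.UnitVectorPairs
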